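import Literature.AlgebraicGeometry.Resolution.RegularLocalOrderValuation
import Literature.AlgebraicGeometry.Resolution.AdicOrderBasics
import Literature.AlgebraicGeometry.CossartPiltant200819.OrderAtClosedPoint2009
import Summits.ResolutionOfSingularities.ResolutionOfSingularities.Theorems.FrobeniusClosingSteerNormalStart
import Mathlib.RingTheory.Derivation.Basic
import Mathlib.RingTheory.Filtration
import Mathlib.Algebra.CharP.Lemmas
import HarnessLib

/-!
# Crux `Steer` (stmt-ResolutionOfSingularities-16345), chain W4.1 — σ-residual LOW at `p = 2`, piece **D3b (F1 β-DROP)**: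
# curve steps of the critical-surface tower spend the CLEANING BUDGET `β = ord_𝔪(dh)` two at a time

OURS (campaign `res-hironaka`, rung L, slot W4.1, chain W4.1; replaces the role of no printed item; NOT a statement of the
manuscript under review [claim: Hironaka2017, status: under-review]; AI review is weaker than expert review).  Theses-free,
definition-free helper for the LOW half of the σ-residual of the line of record `Cruxes/Steer/Lines/switching_dichotomy.lean`
(holder res-L0-w41-lead-1, r26): the tree PORT of res-L0-w41-idea-3's PROVED kernels `curveStep_derivation` / `cleaningBudget`
(card 3 v3 `hyperbolic-splitting-p2`, `L/res-L0-w41-idea-3/Sketch.lean` 002c191ce4e71718 §5.1–§5.4), dealt to this seat by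
res-L0-w41-plan-1 RULING 20b/22b (g9) as **D3b (F1 β-DROP)** of the assembly `D3 = D3a ∘ D3b ∘ D3c ∘ D3d ⇒
LowRunTamedMixedBranchTwo`, together with the BUDGET CONSEQUENCE the card states in prose (F1 «curve bursts are finite»):

> In characteristic `2` let `ω = dh` (all derivation values `D h`).  Cleaning `h ↦ h − g²` does not change `ω`; a CURVE STEP
> `h − g² = w² · h'` gives `w² · D h' = D h`.  Hence along a chain of `n` curve steps `D h₀ = (∏ wᵢ)² · D hₙ ∈ 𝔞^{2n}` when the
> `wᵢ` lie in `𝔞`; so if `D h₀ ∉ 𝔞^B` the chain has `2n < B` — in a Noetherian local ring with `D h₀ ≠ 0` the curve bursts from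
> `h₀` are uniformly bounded (`exists_curveChain_bound`), i.e. an eternal LOW run has infinitely many point steps.  In a REGULAR
> local ring the drop is EXACT: `ord_𝔪 (D h) = ord_𝔪 (D h') + 2 · ord_𝔪 w` (`adicOrder_curveStep`), `= ord_𝔪 (D h') + 2` for a
> regular parameter `w` — the card's «β ↦ β − 2 EXACTLY».

Elementary over the tree's `adicOrder` valuation (`RegularLocalOrderValuation`) and the derivation/power lemmas of
`OrderAtClosedPoint2009`; no named facts, no definitions, no `sorry`. [cite: ZariskiSamuel1960, Ch. VIII §1 Thm. 1 (order valuation of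
a regular local ring)] [folklore]
-/

noncomputable section

-- `Summit.<S>.<S>.…` duplicates the summit name by design (single-problem summit).
set_option linter.dupNamespace false
set_option autoImplicit false

namespace Summit.ResolutionOfSingularities.ResolutionOfSingularities.Theorems.SwitchingDichotomy.CurveStepCleaning

open IsLocalRing
open Literature.AlgebraicGeometry.Resolution (adicOrder adicOrder_mul adicOrder_pow adicOrder_eq_one_iff
  le_adicOrder_iff adicOrder_ne_top)
open Literature.AlgebraicGeometry.CossartPiltant200819.OrderAtClosedPoint (derivation_apply_mem_pow derivation_apply_pow_char)

universe u

/-! ### §1 The characteristic-2 identities (idea-3 Sketch v3 §5.1–§5.4, ported) -/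

section Identities

variable {A : Type u} [CommRing A] [CharP A 2] (D : Derivation ℤ A A)

/-- §5.1 (F2: the exact 1-form `ω = dh` is CLEANING-INVARIANT): `D (h − g²) = D h` in characteristic `2`.
(idea-3 `derivation_sub_sq`.) [folklore] -/
theorem derivation_sub_sq (h g : A) : D (h - g ^ 2) = D h := by
  rw [map_sub, derivation_apply_pow_char 2 D g, sub_zero]

/-- §5.2 (F1 kernel — the CLEANING BUDGET): `h − g² ∈ 𝔞^(N+1) ⇒ D h ∈ 𝔞^N`.  (idea-3 `cleaningBudget`.) [folklore] -/
theorem cleaningBudget (𝔞 : Ideal A) (h g : A) (N : ℕ) (hN : h - g ^ 2 ∈ 𝔞 ^ (N + 1)) : D h ∈ 𝔞 ^ N := by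
  rw [← derivation_sub_sq D h g]
  exact derivation_apply_mem_pow D 𝔞 N hN

/-- §5.3 (F1/F2 — CURVE-STEP LAW `ω' = ω / w̄²`): if `h − g² = w² · h'` then `w² · D h' = D h`.  (idea-3
`curveStep_derivation`.) [folklore] -/
theorem curveStep_derivation (h g w h' : A) (hstep : h - g ^ 2 = w ^ 2 * h') : w ^ 2 * D h' = D h := by
  have key := congrArg D hstep
  rw [derivation_sub_sq D h g, D.leibniz, derivation_apply_pow_char 2 D w, smul_zero, add_zero, smul_eq_mul] at key
  exact key.symm

end Identities

/-- §5.4 (C9/F2 — POINT-STEP LAW `ω' = π*ω / x²`), in a field of characteristic `2`: `x · D (h / x²) = D h / x` for `x ≠ 0`.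
(idea-3 `pointStep_derivation`.) [folklore] -/
theorem pointStep_derivation {K : Type u} [Field K] [CharP K 2] (D : Derivation ℤ K K) (h x : K) (hx : x ≠ 0) :
    x * D (h / x ^ 2) = D h / x := by
  have hsq : D ((x⁻¹) ^ 2) = 0 := derivation_apply_pow_char 2 D x⁻¹
  have hrew : h / x ^ 2 = h * (x⁻¹) ^ 2 := by rw [div_eq_mul_inv, inv_pow]
  rw [hrew, D.leibniz, hsq, smul_zero, zero_add, smul_eq_mul]
  field_simp

/-! ### §2 Chains of curve steps: `D h₀ = (∏ wᵢ)² · D hₙ`, and the budget `2n < B` -/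

section Chains

variable {A : Type u} [CommRing A] [CharP A 2] (D : Derivation ℤ A A)

/-- **Chain law.** Along a chain of curve steps `h i − (g i)² = (w i)² · h (i+1)` (`i < n`):
`D (h 0) = (∏_{i<n} w i) ^ 2 · D (h n)`. [folklore] -/
theorem derivation_apply_chain (h g w : ℕ → A) (n : ℕ) (hstep : ∀ i, i < n → h i - g i ^ 2 = w i ^ 2 * h (i + 1)) :
    D (h 0) = (∏ i ∈ Finset.range n, w i) ^ 2 * D (h n) := by
  induction n with
  | zero => simp
  | succ n ih =>
    rw [ih (fun i hi => hstep i (Nat.lt_succ_of_lt hi)), Finset.prod_range_succ, mul_pow, mul_assoc,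
      curveStep_derivation D (h n) (g n) (w n) (h (n + 1)) (hstep n (Nat.lt_succ_self n))]

/-- **Budget, ideal form.** If moreover every `w i` (`i < n`) lies in the ideal `𝔞`, then `D (h 0) ∈ 𝔞 ^ (2 n)`. [folklore] -/
theorem derivation_apply_mem_pow_of_chain (𝔞 : Ideal A) (h g w : ℕ → A) (n : ℕ)
    (hstep : ∀ i, i < n → h i - g i ^ 2 = w i ^ 2 * h (i + 1)) (hw : ∀ i, i < n → w i ∈ 𝔞) :
    D (h 0) ∈ 𝔞 ^ (2 * n) := by
  rw [derivation_apply_chain D h g w n hstep]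
  refine Ideal.mul_mem_right _ _ ?_
  have hprod : (∏ i ∈ Finset.range n, w i) ∈ 𝔞 ^ n := by
    have := Ideal.prod_mem_prod (s := Finset.range n) (I := fun _ => 𝔞) (x := w) fun i hi => hw i (Finset.mem_range.mp hi)
    rwa [Finset.prod_const, Finset.card_range] at this
  rw [mul_comm, pow_mul]
  exact Ideal.pow_mem_pow hprod 2

/-- **F1 · CURVE BURSTS ARE FINITE (budget form).** If `D (h 0) ∉ 𝔞 ^ B`, a chain of `n` curve steps from `h 0` with all
`w i ∈ 𝔞` has `2 n < B`. [folklore] -/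
theorem two_mul_lt_of_chain (𝔞 : Ideal A) (h g w : ℕ → A) (n : ℕ)
    (hstep : ∀ i, i < n → h i - g i ^ 2 = w i ^ 2 * h (i + 1)) (hw : ∀ i, i < n → w i ∈ 𝔞)
    {B : ℕ} (hB : D (h 0) ∉ 𝔞 ^ B) : 2 * n < B := by
  by_contra hle
  push Not at hle
  exact hB (Ideal.pow_le_pow_right hle (derivation_apply_mem_pow_of_chain D 𝔞 h g w n hstep hw))

/-- **F1 · CURVE BURSTS ARE FINITE (Noetherian local form).** In a Noetherian local ring of characteristic `2`, if `D h₀ ≠ 0`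
then there is a bound `B` such that EVERY chain of curve steps `h i − (g i)² = (w i)² · h (i+1)` starting at `h₀` with the
`w i` in the maximal ideal has length `n` with `2 n < B` (Krull's intersection theorem supplies `B` with `D h₀ ∉ 𝔪 ^ B`).
Hence between two point steps of an eternal LOW run only finitely many curve steps occur. [folklore] -/
theorem exists_curveChain_bound [IsNoetherianRing A] [IsLocalRing A] {h₀ : A} (hD : D h₀ ≠ 0) :
    ∃ B : ℕ, ∀ (h g w : ℕ → A) (n : ℕ), h 0 = h₀ →
      (∀ i, i < n → h i - g i ^ 2 = w i ^ 2 * h (i + 1)) → (∀ i, i < n → w i ∈ maximalIdeal A) → 2 * n < B := by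
  -- Krull: `D h₀ ∉ 𝔪 ^ B` for some `B`
  have hB : ∃ B : ℕ, D h₀ ∉ maximalIdeal A ^ B := by
    by_contra hall
    push Not at hall
    have hmem : D h₀ ∈ ⨅ n : ℕ, maximalIdeal A ^ n := Ideal.mem_iInf.mpr hall
    rw [(maximalIdeal A).iInf_pow_eq_bot_of_isLocalRing (maximalIdeal.isMaximal A).ne_top] at hmem
    exact hD (Ideal.mem_bot.mp hmem)
  obtain ⟨B, hB⟩ := hB
  refine ⟨B, fun h g w n h0 hstep hw => ?_⟩
  subst h0
  exact two_mul_lt_of_chain D (maximalIdeal A) h g w n hstep hw hB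

end Chains

/-! ### §3 The EXACT drop in a regular local ring: `ord (D h) = ord (D h') + 2 · ord w` -/

section Exact

variable {A : Type u} [CommRing A] [IsRegularLocalRing A] [CharP A 2] (D : Derivation ℤ A A)

/-- **β-DROP, exact.** In a regular local ring of characteristic `2` (the `𝔪`-adic order is a valuation), a curve step
`h − g² = w² · h'` gives `ord (D h) = 2 · ord w + ord (D h')`. [cite: ZariskiSamuel1960, Ch. VIII §1 Thm. 1] [folklore] -/
theorem adicOrder_curveStep (h g w h' : A) (hstep : h - g ^ 2 = w ^ 2 * h') :
    adicOrder (D h) = 2 * adicOrder w + adicOrder (D h') := by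
  rw [← curveStep_derivation D h g w h' hstep, adicOrder_mul, adicOrder_pow, Nat.cast_ofNat]

/-- **β-DROP BY EXACTLY `2`** for a regular parameter `w` (`ord w = 1`, i.e. `w ∈ 𝔪 ∖ 𝔪²`):
`ord (D h) = ord (D h') + 2` — idea-3's F1 «β ↦ β − 2 EXACTLY» for each derivation `D` (hence for `β = min_j ord (D_j h)`).
[cite: ZariskiSamuel1960, Ch. VIII §1 Thm. 1] [folklore] -/
theorem adicOrder_curveStep_of_adicOrder_eq_one (h g w h' : A) (hstep : h - g ^ 2 = w ^ 2 * h')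
    (hw : adicOrder w = 1) : adicOrder (D h) = adicOrder (D h') + 2 := by
  rw [adicOrder_curveStep D h g w h' hstep, hw, mul_one, add_comm]

/-- The two-derivation form of the exact drop (idea-3's `β = ord_𝔪(ω)`, `ω = (D₁ h, D₂ h)` the Jacobian pair on the critical
surface): `min (ord D₁ h) (ord D₂ h) = min (ord D₁ h') (ord D₂ h') + 2`. [folklore] -/
theorem min_adicOrder_curveStep_of_adicOrder_eq_one (D₁ D₂ : Derivation ℤ A A) (h g w h' : A)
    (hstep : h - g ^ 2 = w ^ 2 * h') (hw : adicOrder w = 1) :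
    min (adicOrder (D₁ h)) (adicOrder (D₂ h)) = min (adicOrder (D₁ h')) (adicOrder (D₂ h')) + 2 := by
  rw [adicOrder_curveStep_of_adicOrder_eq_one D₁ h g w h' hstep hw,
    adicOrder_curveStep_of_adicOrder_eq_one D₂ h g w h' hstep hw, min_add_add_right]

end Exact

/-! ### §4 No eternal curve tail (rev 2, the TOWER-LEVEL form of D3b for the §σ2.24 glue) -/

section NoEternalTail

variable {A : Type u} [CommRing A] [CharP A 2] (D : Derivation ℤ A A)

/-- **D3b, TOWER LEVEL · no eternal tail of curve steps.** In a Noetherian local ring of characteristic `2`, an INFINITE chain of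
curve steps `h i − (g i)² = (w i)² · h (i+1)` with every `w i ∈ 𝔪` forces `D (h 0) = 0` for every derivation `D` — equivalently,
if some `D (h 0) ≠ 0` (the surface radicand is not a square: `dh ≠ 0`), the critical-surface tower cannot take curve steps for ever
from stage `0`: a point step must occur.  (Apply at the stage where the purported eternal curve tail starts: along curve steps the
surface ring `A` does not change — res-D-pv-012's D3a (M2).) [folklore] -/
theorem derivation_apply_eq_zero_of_eternal_curveChain [IsNoetherianRing A] [IsLocalRing A] (h g w : ℕ → A)
    (hstep : ∀ i, h i - g i ^ 2 = w i ^ 2 * h (i + 1)) (hw : ∀ i, w i ∈ maximalIdeal A) : D (h 0) = 0 := by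
  by_contra hD
  obtain ⟨B, hB⟩ := exists_curveChain_bound D hD
  have h := hB h g w B rfl (fun i _ => hstep i) (fun i _ => hw i)
  omega

/-- Contrapositive packaging: `D (h 0) ≠ 0` ⇒ NO sequences `g, w` (with `w i ∈ 𝔪`) realise an eternal curve chain from `h 0`. [folklore] -/
theorem not_eternal_curveChain [IsNoetherianRing A] [IsLocalRing A] {h₀ : A} (hD : D h₀ ≠ 0) (h g w : ℕ → A) (h0 : h 0 = h₀)
    (hw : ∀ i, w i ∈ maximalIdeal A) : ¬ ∀ i, h i - g i ^ 2 = w i ^ 2 * h (i + 1) := by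
  intro hstep
  subst h0
  exact hD (derivation_apply_eq_zero_of_eternal_curveChain D h g w hstep hw)

/-- **Eventual form** (the shape an «eventually all steps are curve steps» hypothesis produces): if from stage `n₀` on every step is a
curve step with `w i ∈ 𝔪` (in the FIXED ring `A`), then `D (h n₀) = 0` for every derivation `D`. [folklore] -/
theorem derivation_apply_eq_zero_of_eventual_curveChain [IsNoetherianRing A] [IsLocalRing A] (h g w : ℕ → A) (n₀ : ℕ)
    (hstep : ∀ i, n₀ ≤ i → h i - g i ^ 2 = w i ^ 2 * h (i + 1)) (hw : ∀ i, n₀ ≤ i → w i ∈ maximalIdeal A) :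
    D (h n₀) = 0 :=
  derivation_apply_eq_zero_of_eternal_curveChain D (fun i => h (n₀ + i)) (fun i => g (n₀ + i)) (fun i => w (n₀ + i))
    (fun i => by rw [show n₀ + (i + 1) = n₀ + i + 1 from rfl]; exact hstep _ (Nat.le_add_right _ _))
    (fun i => hw _ (Nat.le_add_right _ _))

end NoEternalTail

/-! ### §5 An eternal curve tail forces the surface radicand to be a SQUARE (rev 2; detection by `NormalStart`) -/

section Square

universe w

/-- **D3b · consumer form.** Let `A` be a Noetherian local domain, integrally closed, essentially of finite type over a PERFECT field `k` of
characteristic `2` (the surface germ `A_n` of the critical-surface tower at a closed point: regular ⇒ integrally closed).  If from stage `n₀`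
on the tower takes only CURVE steps in the fixed ring `A` (`h i − (g i)² = (w i)² · h (i+1)`, `w i ∈ 𝔪`, `i ≥ n₀` — res-D-pv-012's D3a
(M2)/(M3)), then the radicand `h n₀` is a SQUARE in `A`: every derivation kills it (`derivation_apply_eq_zero_of_eventual_curveChain`), and
derivations detect non-squares (`NormalStart.exists_derivation_apply_ne_zero`, p514532).  Contrapositive = idea-3 F1: a non-square surface
radicand admits no eternal curve tail, so an eternal LOW run has infinitely many point steps. [cite: Matsumura1987, §26 Thm. 26.5] [folklore] -/
theorem exists_sq_eq_of_eventual_curveChain (k : Type w) [Field k] [CharP k 2] [PerfectField k]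
    {A : Type u} [CommRing A] [IsDomain A] [IsNoetherianRing A] [IsLocalRing A] [IsIntegrallyClosed A]
    [Algebra k A] [Algebra.EssFiniteType k A]
    (h g w : ℕ → A) (n₀ : ℕ) (hstep : ∀ i, n₀ ≤ i → h i - g i ^ 2 = w i ^ 2 * h (i + 1))
    (hw : ∀ i, n₀ ≤ i → w i ∈ maximalIdeal A) : ∃ c : A, h n₀ = c ^ 2 := by
  haveI : Fact (Nat.Prime 2) := ⟨Nat.prime_two⟩
  haveI : CharP A 2 := charP_of_injective_algebraMap (algebraMap k A).injective 2
  by_contra hne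
  push Not at hne
  obtain ⟨D, hD⟩ := NormalStart.exists_derivation_apply_ne_zero k 2 (f := h n₀) hne
  exact hD (derivation_apply_eq_zero_of_eventual_curveChain D h g w n₀ hstep hw)

/-- **D3b · consumer form for SUBRINGS of the residue field** (res-D-pv-012's D3a presents the surface germs as subrings
`A n = φ(R n) ≤ κ(P₀)` of ONE field and the tower data `h, ḡ, w̄ : ℕ → κ`): if from stage `n₀` on all data lie in the fixed subring `A`
(curve steps leave `A` unchanged, (M2)), the chart parameters `w i` lie in `𝔪_A`, and `h i − (g i)² = (w i)² · h (i+1)` ((M3)), then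
`h n₀` is a square of an element of `A`. [folklore] -/
theorem exists_sq_eq_of_eventual_curveChain_subring (k : Type w) [Field k] [CharP k 2] [PerfectField k]
    {κ : Type u} [Field κ] (A : Subring κ) [IsNoetherianRing A] [IsLocalRing A] [IsIntegrallyClosed A]
    [Algebra k A] [Algebra.EssFiniteType k A]
    (h g w : ℕ → κ) (n₀ : ℕ) (hh : ∀ i, n₀ ≤ i → h i ∈ A) (hg : ∀ i, n₀ ≤ i → g i ∈ A)
    (hw : ∀ i, n₀ ≤ i → ∃ hwi : w i ∈ A, (⟨w i, hwi⟩ : A) ∈ maximalIdeal A)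
    (hstep : ∀ i, n₀ ≤ i → h i - g i ^ 2 = w i ^ 2 * h (i + 1)) : ∃ c ∈ A, h n₀ = c ^ 2 := by
  have hle : ∀ i : ℕ, n₀ ≤ n₀ + i := fun i => Nat.le_add_right _ _
  obtain ⟨c, hc⟩ := exists_sq_eq_of_eventual_curveChain k
    (fun i => (⟨h (n₀ + i), hh _ (hle i)⟩ : A)) (fun i => (⟨g (n₀ + i), hg _ (hle i)⟩ : A))
    (fun i => (⟨w (n₀ + i), (hw _ (hle i)).choose⟩ : A)) 0
    (fun i _ => Subtype.ext (by
      change h (n₀ + i) - g (n₀ + i) ^ 2 = w (n₀ + i) ^ 2 * h (n₀ + (i + 1))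
      rw [← Nat.add_assoc]
      exact hstep _ (hle i)))
    (fun i _ => (hw _ (hle i)).choose_spec)
  refine ⟨c, c.2, ?_⟩
  have := congrArg (fun x : A => (x : κ)) hc
  simpa using this

end Square

end Summit.ResolutionOfSingularities.ResolutionOfSingularities.Theorems.SwitchingDichotomy.CurveStepCleaning
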